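import Literature.Geometry.Lorentzian.KerrStarCoord
import Literature.Geometry.Lorentzian.KerrEnergyIdentity
import HarnessLib

/-!
# The Carter operator is a symmetry operator: the radial and the angular parts of `ρ² □_g` in the
# coordinates `(t*, r, θ, φ*)` commute (axisymmetric functions)

(family `gr`; namespace `Literature.Geometry.Lorentzian.Kerr.StarCoord`; written from the proving
seat of `Literature.Barriers.FinalStateConjecture.Aretakis2012_pointwiseDecay` — Aretakis, JFA 263
(2012), Thm. 5 — whose printed proof commutes the wave equation with the Carter operator `Q`:
§5.3 "since `[Q, □_g] = 0`, `Qψ` is also a solution", used in §15, Lemma 15.0.1.)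

In the coordinates `q = (t*, r, θ, φ*)` of `KerrStarWaveOperator.lean` the Kerr wave operator on
functions with `∂_{φ*} = 0` is `ρ² □_g = 𝓡 + 𝓐` with a **radial part**
`𝓡 = Δ ∂₁∂₁ + Δ' ∂₁ + 4Mr ∂₁∂₀ + 2M ∂₀ − (r² + a² + 2Mr) ∂₀∂₀` (`radOp`, coefficients depending on
`r = q 1` only) and an **angular part** `𝓐 = a² sin² θ ∂₀∂₀ + ∂₂∂₂ + cot θ ∂₂` (`angOp`,
coefficients depending on `θ = q 2` only) — the Carter operator `Q = Δ̸ + a² sin² θ ∂_v² + 2a∂_v∂_φ`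
restricted to axisymmetric functions. This file is pure calculus on coordinate space `E4` and
proves, for functions `G` smooth on an open set `W ⊆ {sin θ ≠ 0}`:

* `pd i G = ∂_i G` (coordinate derivatives as an operator on functions) with its calculus on open
  sets of smoothness: congruence (`pd_congr`), smoothness (`contDiffOn_pd`), sum/product rules,
  **symmetry of mixed partials** (`pd_comm`, from `ContDiffAt.isSymmSndFDerivAt`) and the moving
  lemmas `pd_move₂`, `pd_move₃`;
* `pd_radOp` / `pd_angOp`: `∂_i 𝓡 = 𝓡 ∂_i` for `i ≠ 1` and `∂_i 𝓐 = 𝓐 ∂_i` for `i ≠ 2` on `W`;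
* `angOp_radOp_comm` (**the commutation**): `𝓐(𝓡 G) = 𝓡(𝓐 G)` on `W` — i.e. `[ρ²□_g − Q, Q] = 0`,
  `[□_g, Q] = 0` on axisymmetric functions, from the explicit coordinate form (thirteen reorderings
  of mixed partials up to order four);
* `separated_radOp` (**the symmetry property**): if `𝓡 G + 𝓐 G = 0` on `W` then
  `𝓡(𝓡 G) + 𝓐(𝓡 G) = 0` on `W` (`𝓐𝓡G = 𝓡𝓐G = 𝓡(−𝓡G) = −𝓡𝓡G`): with `G = ψ ∘ κ` for an
  axisymmetric solution `ψ` this says that `𝓡ψ = −Qψ` is again a solution;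
* `pd_three_radOp_eq_zero`: `∂_φ G = 0` on `W` implies `∂_φ(𝓡 G) = 0` on `W`.

The passage from the chart function `ψ` to `G = ψ ∘ κ` and back (`Kerr.blSigma_mul_coordWave_starChart`)
and the resulting closure of Aretakis's class of axisymmetric solutions under `𝓡` are carried out in
the barrier catalogue (`Literature/Barriers/FinalStateConjecture/`).

## References

* S. Aretakis, *Decay of axisymmetric solutions of the wave equation on extreme Kerr backgrounds*,
  J. Funct. Anal. 263 (2012) 2770–2831 (arXiv:1110.2006): §2.4 (coordinates), §5.3 (the Carter
  operator `Q`, `[Q, □_g] = 0`, the symmetry operators `𝕊₂ ∋ Q`), §15 (Lemma 15.0.1)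
  (key `Aretakis2012`).
* B. Carter, *Global structure of the Kerr family of gravitational fields*, Phys. Rev. 174 (1968)
  1559–1571, and Comm. Math. Phys. 10 (1968) 280–310 (separability of the wave equation on Kerr)
  — cited through Aretakis 2012, §5.3.
-/

noncomputable section

open Real Set Filter
open scoped Topology ContDiff

namespace Literature.Geometry.Lorentzian

namespace Kerr

namespace StarCoord

/-! ### Coordinate derivatives of functions on coordinate space, on an open set -/

/-- The coordinate derivative operator `∂_i G (q) = DG(q) ∂_i` on functions `E4 → ℝ` of the
coordinate quadruple `q = (t*, r, θ, φ)`. [folklore] -/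
def pd (i : Fin 4) (G : E4 → ℝ) : E4 → ℝ := fun q ↦ fderiv ℝ G q (E4.basisVector i)

/-- Unfolding lemma. [folklore] -/
theorem pd_apply (i : Fin 4) (G : E4 → ℝ) (q : E4) : pd i G q = fderiv ℝ G q (E4.basisVector i) := rfl

variable {W : Set E4}

/-- Functions agreeing on an open set have the same derivatives there. [folklore] -/
theorem pd_congr (hW : IsOpen W) {G₁ G₂ : E4 → ℝ} (h : EqOn G₁ G₂ W) (i : Fin 4) :
    EqOn (pd i G₁) (pd i G₂) W := by
  intro q hq
  simp only [pd]
  rw [(h.eventuallyEq_of_mem (hW.mem_nhds hq)).fderiv_eq]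

/-- The derivative of a function smooth on an open set is smooth there. [folklore] -/
theorem contDiffOn_pd (hW : IsOpen W) {G : E4 → ℝ} (hG : ContDiffOn ℝ ∞ G W) (i : Fin 4) :
    ContDiffOn ℝ ∞ (pd i G) W := by
  have h1 : ContDiffOn ℝ ∞ (fderiv ℝ G) W := hG.fderiv_of_isOpen hW le_rfl
  exact h1.clm_apply contDiffOn_const

/-- `∂_i` is additive. [folklore] -/
theorem pd_add (hW : IsOpen W) {G₁ G₂ : E4 → ℝ} (h₁ : ContDiffOn ℝ ∞ G₁ W)
    (h₂ : ContDiffOn ℝ ∞ G₂ W) (i : Fin 4) :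
    EqOn (pd i (G₁ + G₂)) (pd i G₁ + pd i G₂) W := by
  intro q hq
  have d₁ : DifferentiableAt ℝ G₁ q := (h₁.contDiffAt (hW.mem_nhds hq)).differentiableAt (by simp)
  have d₂ : DifferentiableAt ℝ G₂ q := (h₂.contDiffAt (hW.mem_nhds hq)).differentiableAt (by simp)
  simp only [pd, Pi.add_apply]
  rw [fderiv_add d₁ d₂]
  rfl

/-- `∂_i` of a difference. [folklore] -/
theorem pd_sub (hW : IsOpen W) {G₁ G₂ : E4 → ℝ} (h₁ : ContDiffOn ℝ ∞ G₁ W)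
    (h₂ : ContDiffOn ℝ ∞ G₂ W) (i : Fin 4) :
    EqOn (pd i (G₁ - G₂)) (pd i G₁ - pd i G₂) W := by
  intro q hq
  have d₁ : DifferentiableAt ℝ G₁ q := (h₁.contDiffAt (hW.mem_nhds hq)).differentiableAt (by simp)
  have d₂ : DifferentiableAt ℝ G₂ q := (h₂.contDiffAt (hW.mem_nhds hq)).differentiableAt (by simp)
  simp only [pd, Pi.sub_apply]
  rw [fderiv_sub d₁ d₂]
  rfl

/-- `∂_i` of a negative. [folklore] -/
theorem pd_neg {G : E4 → ℝ} (i : Fin 4) (q : E4) : pd i (-G) q = -pd i G q := by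
  simp only [pd]
  rw [fderiv_neg]
  rfl

/-- **Product rule** for `∂_i`. [folklore] -/
theorem pd_mul (hW : IsOpen W) {c G : E4 → ℝ} (hc : ContDiffOn ℝ ∞ c W) (hG : ContDiffOn ℝ ∞ G W)
    (i : Fin 4) :
    EqOn (pd i (c * G)) (pd i c * G + c * pd i G) W := by
  intro q hq
  have dc : DifferentiableAt ℝ c q := (hc.contDiffAt (hW.mem_nhds hq)).differentiableAt (by simp)
  have dG : DifferentiableAt ℝ G q := (hG.contDiffAt (hW.mem_nhds hq)).differentiableAt (by simp)
  simp only [pd, Pi.add_apply, Pi.mul_apply]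
  rw [fderiv_mul dc dG]
  simp only [FunLike.coe_add, Pi.add_apply, FunLike.coe_smul, Pi.smul_apply, smul_eq_mul]
  ring

/-- Constant multiples. [folklore] -/
theorem pd_const_mul (hW : IsOpen W) {G : E4 → ℝ} (hG : ContDiffOn ℝ ∞ G W) (c : ℝ) (i : Fin 4) :
    EqOn (pd i (fun q ↦ c * G q)) (fun q ↦ c * pd i G q) W := by
  intro q hq
  have dG : DifferentiableAt ℝ G q := (hG.contDiffAt (hW.mem_nhds hq)).differentiableAt (by simp)
  simp only [pd]
  rw [fderiv_const_mul dG]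
  rfl

/-- `minSmoothness ℝ 2 ≤ ∞` (bookkeeping for the symmetry of second derivatives; the same statement
as `minSmoothness_two_le_infty` of a barrier file this geometry file must not import). [folklore] -/
private theorem minSmoothness_two_le_infty' : minSmoothness ℝ 2 ≤ (∞ : WithTop ℕ∞) := by
  rw [minSmoothness_of_isRCLikeNormedField]
  exact WithTop.coe_le_coe.mpr le_top

/-- The iterated coordinate derivative is the second derivative: `∂_i∂_j G(q) = D²G(q)(∂_i, ∂_j)` at
points of smoothness. [folklore] -/
theorem pd_pd_eq_fderiv_fderiv {G : E4 → ℝ} {q : E4} (hG : ContDiffAt ℝ ∞ G q) (i j : Fin 4) :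
    pd i (pd j G) q = fderiv ℝ (fderiv ℝ G) q (E4.basisVector i) (E4.basisVector j) := by
  have hB : HasFDerivAt (fderiv ℝ G) (fderiv ℝ (fderiv ℝ G) q) q :=
    ((hG.fderiv_right (m := ∞) le_rfl).differentiableAt (by simp)).hasFDerivAt
  have h' : HasFDerivAt (fun q' ↦ fderiv ℝ G q' (E4.basisVector j))
      ((fderiv ℝ (fderiv ℝ G) q).flip (E4.basisVector j)) q := by
    simpa using hB.clm_apply (hasFDerivAt_const (E4.basisVector j) q)
  rw [pd_apply, show pd j G = fun q' ↦ fderiv ℝ G q' (E4.basisVector j) from rfl, h'.fderiv,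
    ContinuousLinearMap.flip_apply]

/-- **Symmetry of second coordinate derivatives** on an open set of smoothness. [folklore] -/
theorem pd_comm (hW : IsOpen W) {G : E4 → ℝ} (hG : ContDiffOn ℝ ∞ G W) (i j : Fin 4) :
    EqOn (pd i (pd j G)) (pd j (pd i G)) W := by
  intro q hq
  have hq' : ContDiffAt ℝ ∞ G q := hG.contDiffAt (hW.mem_nhds hq)
  rw [pd_pd_eq_fderiv_fderiv hq', pd_pd_eq_fderiv_fderiv hq']
  exact (hq'.isSymmSndFDerivAt minSmoothness_two_le_infty').eq _ _

/-- Components of the coordinate basis vectors (as in `KerrRedShiftBulk.lean`; private to avoid a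
clash with the barrier files' copy). [folklore] -/
private theorem basisVector_apply (μ ν : Fin 4) : E4.basisVector μ ν = if ν = μ then 1 else 0 :=
  PiLp.single_apply _ _ _ _ _

/-! ### Moving one derivative inside an iterated derivative -/

/-- `∂_u ∂_v ∂_w H = ∂_v ∂_w ∂_u H` on an open set of smoothness. [folklore] -/
theorem pd_move₂ (hW : IsOpen W) {H : E4 → ℝ} (hH : ContDiffOn ℝ ∞ H W) (u v w : Fin 4) :
    EqOn (pd u (pd v (pd w H))) (pd v (pd w (pd u H))) W := by
  have h1 : EqOn (pd u (pd v (pd w H))) (pd v (pd u (pd w H))) W := pd_comm hW (contDiffOn_pd hW hH w) u v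
  have h2 : EqOn (pd v (pd u (pd w H))) (pd v (pd w (pd u H))) W := pd_congr hW (pd_comm hW hH u w) v
  exact h1.trans h2

/-- `∂_u ∂_v ∂_w ∂_z H = ∂_v ∂_w ∂_z ∂_u H` on an open set of smoothness. [folklore] -/
theorem pd_move₃ (hW : IsOpen W) {H : E4 → ℝ} (hH : ContDiffOn ℝ ∞ H W) (u v w z : Fin 4) :
    EqOn (pd u (pd v (pd w (pd z H)))) (pd v (pd w (pd z (pd u H)))) W := by
  have h1 : EqOn (pd u (pd v (pd w (pd z H)))) (pd v (pd w (pd u (pd z H)))) W :=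
    pd_move₂ hW (contDiffOn_pd hW hH z) u v w
  have h2 : EqOn (pd v (pd w (pd u (pd z H)))) (pd v (pd w (pd z (pd u H)))) W :=
    pd_congr hW (pd_congr hW (pd_comm hW hH u z) w) v
  exact h1.trans h2

/-! ### The radial and the angular (Carter) parts of `ρ² □_g` on axisymmetric functions -/

section Operators

variable (M a : ℝ)

/-- **The radial part `𝓡` of `ρ² □_g` in the coordinates `(t*, r, θ, φ*)`** acting on functions
of the coordinates with `∂_φ G = 0` (axisymmetric):
`𝓡 G = Δ ∂₁∂₁G + Δ' ∂₁G + 4Mr ∂₁∂₀G + 2M ∂₀G − (r² + a² + 2Mr) ∂₀∂₀G`, `Δ = r² − 2Mr + a²`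
(the terms of `Kerr.blSigma_mul_coordWave_starChart` whose coefficients depend on `r`; in the
system `(v, r, θ, φ*)` of Aretakis, JFA 263 (2012), §2.4 and §8 this is
`∂_r Δ ∂_r + 2(r² + a²) ∂_v∂_r + 2r ∂_v − (r² + a²) ∂_v²` restricted to `∂_{φ*} = 0`, i.e.
`ρ² □_g − Q` with `Q` the Carter operator of §5.3). [cite: Aretakis2012, §2.4 and §5.3] -/
def radOp (G : E4 → ℝ) : E4 → ℝ := fun q ↦
  (q 1 ^ 2 - 2 * M * q 1 + a ^ 2) * pd 1 (pd 1 G) q + (2 * q 1 - 2 * M) * pd 1 G q +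
    4 * M * q 1 * pd 1 (pd 0 G) q + 2 * M * pd 0 G q - (q 1 ^ 2 + a ^ 2 + 2 * M * q 1) * pd 0 (pd 0 G) q

/-- **The angular part of `ρ² □_g` on axisymmetric functions — the Carter operator `Q` restricted
to `∂_{φ*} = 0`**: `𝓐 G = a² sin² θ ∂₀∂₀G + ∂₂∂₂G + cot θ ∂₂G`
(`Q = Δ̸_{𝕊²} + a² sin² θ ∂_v² + 2a ∂_v∂_{φ*}` in the system `(v, r, θ, φ*)`; Aretakis, JFA 263
(2012), §5.3; here the coefficients depend on `θ` only). [cite: Aretakis2012, §5.3] -/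
def angOp (G : E4 → ℝ) : E4 → ℝ := fun q ↦
  a ^ 2 * sin (q 2) ^ 2 * pd 0 (pd 0 G) q + pd 2 (pd 2 G) q + cos (q 2) / sin (q 2) * pd 2 G q

variable {M a}

/-- The derivative of a coefficient `q ↦ f(q j)` as a continuous linear map. [folklore] -/
theorem hasFDerivAt_coefFun {j : Fin 4} {f : ℝ → ℝ} {f' : ℝ} {q : E4} (hf : HasDerivAt f f' (q j)) :
    HasFDerivAt (fun q : E4 ↦ f (q j)) (f' • PiLp.proj (𝕜 := ℝ) 2 (fun _ : Fin 4 ↦ ℝ) j) q :=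
  hf.comp_hasFDerivAt q (PiLp.proj (𝕜 := ℝ) 2 (fun _ : Fin 4 ↦ ℝ) j).hasFDerivAt

/-- The coordinate projection vanishes on the other basis vectors: `dq^j(∂_i) = 0`, `i ≠ j`.
[folklore] -/
theorem proj_basisVector_of_ne {i j : Fin 4} (hij : i ≠ j) :
    (PiLp.proj (𝕜 := ℝ) 2 (fun _ : Fin 4 ↦ ℝ) j) (E4.basisVector i) = 0 := by
  rw [show (PiLp.proj (𝕜 := ℝ) 2 (fun _ : Fin 4 ↦ ℝ) j) (E4.basisVector i) = E4.basisVector i j from rfl,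
    basisVector_apply, if_neg hij.symm]

variable (hW : IsOpen W)
include hW

/-- A function smooth on the open set `W` has `fderiv` as its derivative at the points of `W`, and
`DH(q)∂_i = ∂_i H(q)`. [folklore] -/
theorem hasFDerivAt_of_contDiffOn {H : E4 → ℝ} (hH : ContDiffOn ℝ ∞ H W) {q : E4} (hq : q ∈ W) :
    HasFDerivAt H (fderiv ℝ H q) q :=
  ((hH.contDiffAt (hW.mem_nhds hq)).differentiableAt (by simp)).hasFDerivAt

/-- **The radial part of a smooth function is smooth.** [folklore] -/
theorem contDiffOn_radOp {G : E4 → ℝ} (hG : ContDiffOn ℝ ∞ G W) : ContDiffOn ℝ ∞ (radOp M a G) W := by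
  have h11 := contDiffOn_pd hW (contDiffOn_pd hW hG 1) 1
  have h1 := contDiffOn_pd hW hG 1
  have h10 := contDiffOn_pd hW (contDiffOn_pd hW hG 0) 1
  have h0 := contDiffOn_pd hW hG 0
  have h00 := contDiffOn_pd hW (contDiffOn_pd hW hG 0) 0
  have hc : ∀ j : Fin 4, ContDiffOn ℝ ∞ (fun q : E4 ↦ q j) W := fun j ↦ (contDiff_coord j).contDiffOn
  unfold radOp
  exact ((((((((hc 1).pow 2).sub (contDiffOn_const.mul (hc 1))).add contDiffOn_const).mul h11).add
    (((contDiffOn_const.mul (hc 1)).sub contDiffOn_const).mul h1)).add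
    ((contDiffOn_const.mul (hc 1)).mul h10)).add (contDiffOn_const.mul h0)).sub
    (((((hc 1).pow 2).add contDiffOn_const).add (contDiffOn_const.mul (hc 1))).mul h00)

variable (hWs : ∀ q ∈ W, sin (q 2) ≠ 0)
include hWs

/-- **The angular part of a smooth function is smooth** on `W ⊆ {sin θ ≠ 0}`. [folklore] -/
theorem contDiffOn_angOp {G : E4 → ℝ} (hG : ContDiffOn ℝ ∞ G W) : ContDiffOn ℝ ∞ (angOp a G) W := by
  have h00 := contDiffOn_pd hW (contDiffOn_pd hW hG 0) 0
  have h22 := contDiffOn_pd hW (contDiffOn_pd hW hG 2) 2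
  have h2 := contDiffOn_pd hW hG 2
  have hc2 : ContDiffOn ℝ ∞ (fun q : E4 ↦ q 2) W := (contDiff_coord 2).contDiffOn
  have hsin : ContDiffOn ℝ ∞ (fun q : E4 ↦ sin (q 2)) W := contDiff_sin.comp_contDiffOn hc2
  have hcos : ContDiffOn ℝ ∞ (fun q : E4 ↦ cos (q 2)) W := contDiff_cos.comp_contDiffOn hc2
  unfold angOp
  exact (((contDiffOn_const.mul (hsin.pow 2)).mul h00).add h22).add ((hcos.div hsin hWs).mul h2)

omit hWs in
/-- **A derivative along `∂_{t*}`, `∂_θ` or `∂_φ` passes through the radial part**: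
`∂_i 𝓡 G = 𝓡 ∂_i G` on `W` for `i ≠ 1` (the coefficients depend on `r` only; mixed partials
commute). [folklore] -/
theorem pd_radOp {i : Fin 4} (hi : i ≠ 1) {G : E4 → ℝ} (hG : ContDiffOn ℝ ∞ G W) :
    EqOn (pd i (radOp M a G)) (radOp M a (pd i G)) W := by
  intro q hq
  have h11 := contDiffOn_pd hW (contDiffOn_pd hW hG 1) 1
  have h1 := contDiffOn_pd hW hG 1
  have h10 := contDiffOn_pd hW (contDiffOn_pd hW hG 0) 1
  have h0 := contDiffOn_pd hW hG 0
  have h00 := contDiffOn_pd hW (contDiffOn_pd hW hG 0) 0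
  -- derivatives of the coefficients
  have dc1 : HasFDerivAt (fun q : E4 ↦ q 1 ^ 2 - 2 * M * q 1 + a ^ 2)
      ((2 * q 1 - 2 * M) • PiLp.proj (𝕜 := ℝ) 2 (fun _ : Fin 4 ↦ ℝ) 1) q := by
    refine hasFDerivAt_coefFun (f := fun r ↦ r ^ 2 - 2 * M * r + a ^ 2) ?_
    have h := (((hasDerivAt_id' (q 1)).pow 2).sub ((hasDerivAt_id' (q 1)).const_mul (2 * M))).add_const
      (a ^ 2)
    exact h.congr_deriv (by norm_num)
  have dc2 : HasFDerivAt (fun q : E4 ↦ 2 * q 1 - 2 * M)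
      ((2 : ℝ) • PiLp.proj (𝕜 := ℝ) 2 (fun _ : Fin 4 ↦ ℝ) 1) q := by
    refine hasFDerivAt_coefFun (f := fun r ↦ 2 * r - 2 * M) ?_
    exact (((hasDerivAt_id' (q 1)).const_mul 2).sub_const (2 * M)).congr_deriv (by norm_num)
  have dc3 : HasFDerivAt (fun q : E4 ↦ 4 * M * q 1)
      ((4 * M) • PiLp.proj (𝕜 := ℝ) 2 (fun _ : Fin 4 ↦ ℝ) 1) q := by
    refine hasFDerivAt_coefFun (f := fun r ↦ 4 * M * r) ?_
    exact ((hasDerivAt_id' (q 1)).const_mul (4 * M)).congr_deriv (by norm_num)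
  have dc5 : HasFDerivAt (fun q : E4 ↦ q 1 ^ 2 + a ^ 2 + 2 * M * q 1)
      ((2 * q 1 + 2 * M) • PiLp.proj (𝕜 := ℝ) 2 (fun _ : Fin 4 ↦ ℝ) 1) q := by
    refine hasFDerivAt_coefFun (f := fun r ↦ r ^ 2 + a ^ 2 + 2 * M * r) ?_
    have h := (((hasDerivAt_id' (q 1)).pow 2).add_const (a ^ 2)).add
      ((hasDerivAt_id' (q 1)).const_mul (2 * M))
    exact h.congr_deriv (by norm_num)
  -- the derivative of `𝓡 G` at `q`
  have hD := ((((dc1.mul (hasFDerivAt_of_contDiffOn hW h11 hq)).add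
    (dc2.mul (hasFDerivAt_of_contDiffOn hW h1 hq))).add
    (dc3.mul (hasFDerivAt_of_contDiffOn hW h10 hq))).add
    ((hasFDerivAt_of_contDiffOn hW h0 hq).const_mul (2 * M))).sub
    (dc5.mul (hasFDerivAt_of_contDiffOn hW h00 hq))
  have hfun : HasFDerivAt (radOp M a G) _ q := hD
  rw [pd_apply, hfun.fderiv]
  simp only [FunLike.coe_add, FunLike.coe_sub, Pi.add_apply, Pi.sub_apply, FunLike.coe_smul,
    Pi.smul_apply, smul_eq_mul, proj_basisVector_of_ne hi, mul_zero, add_zero]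
  -- the inner derivatives, moved inside
  simp only [radOp, ← pd_apply]
  rw [pd_move₂ hW hG _ _ _ hq, pd_comm hW hG i 1 hq, pd_move₂ hW hG i 1 0 hq, pd_comm hW hG i 0 hq,
    pd_move₂ hW hG i 0 0 hq]

/-- **A derivative along `∂_{t*}`, `∂_r` or `∂_φ` passes through the angular part**:
`∂_i 𝓐 G = 𝓐 ∂_i G` on `W ⊆ {sin θ ≠ 0}` for `i ≠ 2`. [folklore] -/
theorem pd_angOp {i : Fin 4} (hi : i ≠ 2) {G : E4 → ℝ} (hG : ContDiffOn ℝ ∞ G W) :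
    EqOn (pd i (angOp a G)) (angOp a (pd i G)) W := by
  intro q hq
  have hs : sin (q 2) ≠ 0 := hWs q hq
  have h00 := contDiffOn_pd hW (contDiffOn_pd hW hG 0) 0
  have h22 := contDiffOn_pd hW (contDiffOn_pd hW hG 2) 2
  have h2 := contDiffOn_pd hW hG 2
  have dcs : HasFDerivAt (fun q : E4 ↦ a ^ 2 * sin (q 2) ^ 2)
      ((a ^ 2 * (2 * sin (q 2) * cos (q 2))) • PiLp.proj (𝕜 := ℝ) 2 (fun _ : Fin 4 ↦ ℝ) 2) q := by
    refine hasFDerivAt_coefFun (f := fun θ ↦ a ^ 2 * sin θ ^ 2) ?_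
    have h := ((hasDerivAt_sin (q 2)).pow 2).const_mul (a ^ 2)
    exact h.congr_deriv (by norm_num)
  have dck : HasFDerivAt (fun q : E4 ↦ cos (q 2) / sin (q 2))
      (((-sin (q 2) * sin (q 2) - cos (q 2) * cos (q 2)) / sin (q 2) ^ 2) •
        PiLp.proj (𝕜 := ℝ) 2 (fun _ : Fin 4 ↦ ℝ) 2) q := by
    refine hasFDerivAt_coefFun (f := fun θ ↦ cos θ / sin θ) ?_
    exact (hasDerivAt_cos (q 2)).div (hasDerivAt_sin (q 2)) hs
  have hD := ((dcs.mul (hasFDerivAt_of_contDiffOn hW h00 hq)).add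
    (hasFDerivAt_of_contDiffOn hW h22 hq)).add (dck.mul (hasFDerivAt_of_contDiffOn hW h2 hq))
  have hfun : HasFDerivAt (angOp a G) _ q := hD
  rw [pd_apply, hfun.fderiv]
  simp only [FunLike.coe_add, Pi.add_apply, FunLike.coe_smul, Pi.smul_apply, smul_eq_mul,
    proj_basisVector_of_ne hi, mul_zero, add_zero]
  simp only [angOp, ← pd_apply]
  rw [pd_move₂ hW hG i 0 0 hq, pd_move₂ hW hG i 2 2 hq, pd_comm hW hG i 2 hq]

/-- **The radial part commutes with the angular (Carter) part** on axisymmetric smooth functions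
of the coordinates: `𝓐 (𝓡 G) = 𝓡 (𝓐 G)` on every open `W ⊆ {sin θ ≠ 0}` on which `G` is smooth.
This is the commutation `[ρ²□_g − Q, Q] = 0`, i.e. `[□_g, Q] = 0` on functions, behind "the Carter
operator `Q` is a symmetry operator" (Aretakis, JFA 263 (2012), §5.3: `[Q, □_g] = 0`, from Carter's
separability; here from the explicit coordinate form: the coefficients of `𝓡` depend on `r` only,
those of `𝓐` on `θ` only, and mixed partials commute). [cite: Aretakis2012, §5.3] -/
theorem angOp_radOp_comm {G : E4 → ℝ} (hG : ContDiffOn ℝ ∞ G W) :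
    EqOn (angOp a (radOp M a G)) (radOp M a (angOp a G)) W := by
  intro q hq
  have hR := contDiffOn_radOp (M := M) (a := a) hW hG
  have hA := contDiffOn_angOp (a := a) hW hWs hG
  -- smoothness of first derivatives
  have hG0 := contDiffOn_pd hW hG 0
  have hG1 := contDiffOn_pd hW hG 1
  have hG2 := contDiffOn_pd hW hG 2
  -- left side: `𝓐 (𝓡 G) = s 𝓡(∂₀∂₀G) + 𝓡(∂₂∂₂G) + k 𝓡(∂₂G)` at `q`
  have l00 : pd 0 (pd 0 (radOp M a G)) q = radOp M a (pd 0 (pd 0 G)) q := by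
    rw [pd_congr hW (pd_radOp (M := M) (a := a) hW (by decide : (0 : Fin 4) ≠ 1) hG) _ hq,
      pd_radOp hW (by decide) hG0 hq]
  have l22 : pd 2 (pd 2 (radOp M a G)) q = radOp M a (pd 2 (pd 2 G)) q := by
    rw [pd_congr hW (pd_radOp (M := M) (a := a) hW (by decide : (2 : Fin 4) ≠ 1) hG) _ hq,
      pd_radOp hW (by decide) hG2 hq]
  have l2 : pd 2 (radOp M a G) q = radOp M a (pd 2 G) q := pd_radOp hW (by decide) hG hq
  -- right side: `𝓡 (𝓐 G) = Δ 𝓐(∂₁∂₁G) + Δ' 𝓐(∂₁G) + 4Mr 𝓐(∂₁∂₀G) + 2M 𝓐(∂₀G) − P 𝓐(∂₀∂₀G)`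
  have r11 : pd 1 (pd 1 (angOp a G)) q = angOp a (pd 1 (pd 1 G)) q := by
    rw [pd_congr hW (pd_angOp (a := a) hW hWs (by decide : (1 : Fin 4) ≠ 2) hG) _ hq,
      pd_angOp hW hWs (by decide) hG1 hq]
  have r1 : pd 1 (angOp a G) q = angOp a (pd 1 G) q := pd_angOp hW hWs (by decide) hG hq
  have r10 : pd 1 (pd 0 (angOp a G)) q = angOp a (pd 1 (pd 0 G)) q := by
    rw [pd_congr hW (pd_angOp (a := a) hW hWs (by decide : (0 : Fin 4) ≠ 2) hG) _ hq,
      pd_angOp hW hWs (by decide) hG0 hq]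
  have r0 : pd 0 (angOp a G) q = angOp a (pd 0 G) q := pd_angOp hW hWs (by decide) hG hq
  have r00 : pd 0 (pd 0 (angOp a G)) q = angOp a (pd 0 (pd 0 G)) q := by
    rw [pd_congr hW (pd_angOp (a := a) hW hWs (by decide : (0 : Fin 4) ≠ 2) hG) _ hq,
      pd_angOp hW hWs (by decide) hG0 hq]
  -- canonical ordering of the iterated derivatives (outermost index highest)
  have c1 : pd 1 (pd 1 (pd 2 (pd 2 G))) q = pd 2 (pd 2 (pd 1 (pd 1 G))) q := by
    rw [pd_move₃ hW hG _ _ _ _ hq, pd_move₃ hW hG _ _ _ _ hq]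
  have c2 : pd 1 (pd 2 (pd 2 G)) q = pd 2 (pd 2 (pd 1 G)) q := pd_move₂ hW hG _ _ _ hq
  have c3 : pd 1 (pd 0 (pd 2 (pd 2 G))) q = pd 2 (pd 2 (pd 1 (pd 0 G))) q := by
    rw [pd_congr hW (pd_move₂ hW hG 0 2 2) _ hq, pd_move₂ hW hG0 _ _ _ hq]
  have c4 : pd 0 (pd 2 (pd 2 G)) q = pd 2 (pd 2 (pd 0 G)) q := pd_move₂ hW hG _ _ _ hq
  have c5 : pd 0 (pd 0 (pd 2 (pd 2 G))) q = pd 2 (pd 2 (pd 0 (pd 0 G))) q := by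
    rw [pd_move₃ hW hG _ _ _ _ hq, pd_move₂ hW hG0 _ _ _ hq]
  have c6 : pd 1 (pd 1 (pd 2 G)) q = pd 2 (pd 1 (pd 1 G)) q := by
    rw [pd_move₂ hW hG _ _ _ hq, pd_comm hW hG1 _ _ hq]
  have c7 : pd 1 (pd 2 G) q = pd 2 (pd 1 G) q := pd_comm hW hG _ _ hq
  have c8 : pd 1 (pd 0 (pd 2 G)) q = pd 2 (pd 1 (pd 0 G)) q := by
    rw [pd_congr hW (pd_comm hW hG 0 2) _ hq, pd_comm hW hG0 _ _ hq]
  have c9 : pd 0 (pd 2 G) q = pd 2 (pd 0 G) q := pd_comm hW hG _ _ hq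
  have c10 : pd 0 (pd 0 (pd 2 G)) q = pd 2 (pd 0 (pd 0 G)) q := by
    rw [pd_move₂ hW hG _ _ _ hq, pd_comm hW hG0 _ _ hq]
  have c11 : pd 0 (pd 0 (pd 1 (pd 1 G))) q = pd 1 (pd 1 (pd 0 (pd 0 G))) q := by
    rw [pd_move₃ hW hG _ _ _ _ hq, pd_move₃ hW hG _ _ _ _ hq]
  have c12 : pd 0 (pd 0 (pd 1 G)) q = pd 1 (pd 0 (pd 0 G)) q := by
    rw [pd_move₂ hW hG _ _ _ hq, pd_move₂ hW hG _ _ _ hq]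
  have c13 : pd 0 (pd 0 (pd 1 (pd 0 G))) q = pd 1 (pd 0 (pd 0 (pd 0 G))) q := by
    rw [pd_move₃ hW hG _ _ _ _ hq, pd_move₃ hW hG _ _ _ _ hq]
  -- expand both sides
  show a ^ 2 * sin (q 2) ^ 2 * pd 0 (pd 0 (radOp M a G)) q + pd 2 (pd 2 (radOp M a G)) q +
      cos (q 2) / sin (q 2) * pd 2 (radOp M a G) q =
    (q 1 ^ 2 - 2 * M * q 1 + a ^ 2) * pd 1 (pd 1 (angOp a G)) q + (2 * q 1 - 2 * M) * pd 1 (angOp a G) q +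
      4 * M * q 1 * pd 1 (pd 0 (angOp a G)) q + 2 * M * pd 0 (angOp a G) q -
      (q 1 ^ 2 + a ^ 2 + 2 * M * q 1) * pd 0 (pd 0 (angOp a G)) q
  rw [l00, l22, l2, r11, r1, r10, r0, r00]
  simp only [radOp, angOp]
  rw [c1, c2, c3, c4, c5, c6, c7, c8, c9, c10, c11, c12, c13]
  ring

/-! ### Consequences: congruence, linearity, and the symmetry property on solutions -/

omit hWs in
/-- The radial part respects equality on open sets. [folklore] -/
theorem radOp_congr {G₁ G₂ : E4 → ℝ} (h : EqOn G₁ G₂ W) : EqOn (radOp M a G₁) (radOp M a G₂) W := by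
  intro q hq
  have h1 := pd_congr hW h 1 hq
  have h0 := pd_congr hW h 0 hq
  have h11 := pd_congr hW (pd_congr hW h 1) 1 hq
  have h10 := pd_congr hW (pd_congr hW h 0) 1 hq
  have h00 := pd_congr hW (pd_congr hW h 0) 0 hq
  simp only [radOp, h1, h0, h11, h10, h00]

omit hWs in
/-- The angular part respects equality on open sets. [folklore] -/
theorem angOp_congr {G₁ G₂ : E4 → ℝ} (h : EqOn G₁ G₂ W) : EqOn (angOp a G₁) (angOp a G₂) W := by
  intro q hq
  have h2 := pd_congr hW h 2 hq
  have h22 := pd_congr hW (pd_congr hW h 2) 2 hq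
  have h00 := pd_congr hW (pd_congr hW h 0) 0 hq
  simp only [angOp, h2, h22, h00]

omit hW hWs in
/-- `∂_i (−G) = −∂_i G` as functions. [folklore] -/
theorem pd_neg_fun (G : E4 → ℝ) (i : Fin 4) : pd i (-G) = -pd i G := funext fun q ↦ pd_neg i q

omit hW hWs in
/-- The radial part is odd: `𝓡(−G) = −𝓡 G`. [folklore] -/
theorem radOp_neg (G : E4 → ℝ) (q : E4) : radOp M a (-G) q = -radOp M a G q := by
  simp only [radOp, pd_neg_fun, Pi.neg_apply]
  ring

omit hW hWs in
/-- The radial part of the zero function vanishes. [folklore] -/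
theorem radOp_zero (q : E4) : radOp M a (0 : E4 → ℝ) q = 0 := by
  have h0 : ∀ i, pd i (0 : E4 → ℝ) = 0 := fun i ↦ by
    funext q'; simp [pd]
  simp only [radOp, h0, Pi.zero_apply, mul_zero, add_zero, sub_zero]

/-- **The symmetry property.** If `G` is smooth on the open set `W ⊆ {sin θ ≠ 0}` and satisfies the
separated equation `𝓡 G + 𝓐 G = 0` on `W` (for `G = ψ ∘ κ` with `∂_φ G = 0` this is `ρ² □_g ψ = 0`,
`Kerr.blSigma_mul_coordWave_starChart`), then so does `𝓡 G`: `𝓡(𝓡 G) + 𝓐(𝓡 G) = 0` on `W`.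
Indeed `𝓐(𝓡 G) = 𝓡(𝓐 G) = 𝓡(−𝓡 G) = −𝓡(𝓡 G)`. This is how the Carter operator produces new
solutions from old ones (`Qψ = −𝓡ψ` on axisymmetric solutions): Aretakis, JFA 263 (2012), §5.3
("since `[Q, □_g] = 0`, `Qψ` is also a solution") as used in §15 (Lemma 15.0.1 with `𝕊₂ ∋ Q`).
[cite: Aretakis2012, §5.3 and §15] -/
theorem separated_radOp {G : E4 → ℝ} (hG : ContDiffOn ℝ ∞ G W)
    (h : ∀ q ∈ W, radOp M a G q + angOp a G q = 0) :
    ∀ q ∈ W, radOp M a (radOp M a G) q + angOp a (radOp M a G) q = 0 := by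
  intro q hq
  have hneg : EqOn (angOp a G) (-radOp M a G) W := fun q' hq' ↦ by
    rw [Pi.neg_apply]; linarith [h q' hq']
  rw [angOp_radOp_comm hW hWs hG hq, radOp_congr (M := M) (a := a) hW hneg hq, radOp_neg]
  ring

omit hWs in
/-- **Axisymmetry is preserved by the radial part**: if `∂_φ G = 0` on `W` then `∂_φ (𝓡 G) = 0` on
`W` (`∂_φ` passes through `𝓡`, `pd_radOp`). [folklore] -/
theorem pd_three_radOp_eq_zero {G : E4 → ℝ} (hG : ContDiffOn ℝ ∞ G W) (h3 : EqOn (pd 3 G) 0 W) :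
    EqOn (pd 3 (radOp M a G)) 0 W := by
  intro q hq
  rw [pd_radOp hW (by decide) hG hq, radOp_congr (M := M) (a := a) hW h3 hq]
  exact radOp_zero q

omit hWs in
/-- With `∂_φ G = 0` on `W` also `∂_i∂_φ G = 0` and `∂_φ∂_φ G = 0` there (the `φ`-terms of the full
coordinate operator drop out). [folklore] -/
theorem pd_pd_three_eq_zero {G : E4 → ℝ} (h3 : EqOn (pd 3 G) 0 W) (i : Fin 4) :
    EqOn (pd i (pd 3 G)) 0 W := by
  intro q hq
  rw [pd_congr hW h3 i hq]
  simp [pd]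

end Operators

end StarCoord

end Kerr

end Literature.Geometry.Lorentzian

end
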